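import Mathlib.NumberTheory.LSeries.PrimesInAP
import Mathlib.Algebra.Order.Interval.Finset.SuccPred
import Literature.Barriers.Parity.SiegelZeroPrimePairs
import Literature.NumberTheory.Sieve.ParityWave0
import Literature.NumberTheory.Sieve.SingularSeriesMultiplesMean
import HarnessLib

/-!
# Goldston–Suriajaya, Theorem 2: the pair-sum side (sharp cutoff), proved

Sibling of `Literature/Barriers/Parity/SiegelZeroPrimePairs.lean` (Goldston–Suriajaya,
*Note on the Goldbach conjecture and Landau–Siegel zeros*, arXiv:2104.09407, Theorem 2 = the named
fact `Literature.Barriers.Parity.SiegelZeroPrimePairBarrier`). Everything in this file is PROVED.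

Goldston–Suriajaya evaluate `𝒯(q) = (1/q) ∑_a |Ψ(re(a/q))|²`, `Ψ(z) = ∑ Λ(n) zⁿ`, `r = e^{-1/N}`,
in two ways (§7): through the prime-pair counts `ψ₂(x, k) = ∑_{k < n ≤ x} Λ(n)Λ(n − k)`
(`Literature.Barriers.Parity.primePairLambdaCount`) summed over the shifts `k ≡ 0 (mod q)`, bounded
above by the Hardy–Littlewood Prime-Pair Upper Bound Conjecture and Montgomery's mean value of the
singular series over multiples of `q` (their Lemma 1), and through `∑_b Ψ(r; q, b)²` and the prime
number theorem for progressions with the exceptional-zero term. This file carries out the FIRST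
evaluation for the SHARP cutoff `n, n' ≤ X` instead of the power-series weight `r^{n+n'}` (for
prime PAIRS the square `{n, n' ≤ X}` is exactly the region counted by `∑_b ψ(X; q, b)²`, so no
smoothing is needed; the mechanism and the constants `2 − δ` versus `2` are those of the source):

* `residueSquareSum q X = ∑_{b mod q} ψ(X; q, b)²` (`ψ(X; q, b)` the tree's
  `Literature.NumberTheory.Sieve.ParityWave0.chebyshevPsiMod`), the sharp analogue of `𝒯(q)`
  (GS21 (Tq) and the display after it: `𝒯(q) = ∑_b Ψ(r; q, b)²`);
* `residueSquareSum_eq` — `∑_b ψ(X; q, b)² = ∑_{n ≤ X} Λ(n)² + 2 ∑_{1 ≤ k ≤ X, q ∣ k} ψ₂(X, k)`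
  (GS21 (|Psi|^2)–(Tq): `𝒯(q) = Ψ₂(r, 0) + 2∑_j Ψ₂(r, qj)`);
* `sum_filter_dvd_goldbachSingularSeries_le`, `sum_goldbachSingularSeries_mul_sub_le` —
  `∑_{k ≤ m, q ∣ k} 𝔖(k) ≤ m/φ(q)` and `∑_{k ≤ X, q ∣ k} 𝔖(k)(X − k) ≤ X²/(2φ(q))`, from the tree's
  PROVED uniform upper half of GS21 Lemma 1 (Montgomery),
  `Literature.NumberTheory.Sieve.SingularSeriesMean.sum_goldbachSingularSeries_mul_le`
  (GS21 (Slast), (V_q=) in sharp form);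
* `residueSquareSum_le` — for EVEN `q`, if the conjectured inequality
  `ψ₂(X, k) ≤ (2 − δ)𝔖(k)(X − k) + η𝔖(k)X` holds for all even `2 ≤ k ≤ X`, then
  `∑_b ψ(X; q, b)² ≤ (X + 1) log²X + (2 − δ + 2η) X²/φ(q)` (GS21 (Tqbound):
  `𝒯(q) ≤ (2 − δ)(N²/φ(q))(1 + o(1)) + O(N log²N)`).

The second evaluation and the deduction of Theorem 2 are in
`Literature/Barriers/Parity/SiegelZeroPrimePairsTheorem2.lean`.

## References

* D. A. Goldston, A. I. Suriajaya, *Note on the Goldbach conjecture and Landau–Siegel zeros*,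
  arXiv:2104.09407 (2021), §7 (proof of Theorem 2): (Psi_2(N,k)), (|Psi|^2), (Psi_2conjecture),
  (Tq), (Slast), (Tqbound). [cite: GoldstonSuriajaya2021, §7]
-/

noncomputable section

open Finset Real
open scoped ArithmeticFunction.vonMangoldt

namespace Literature.Barriers.Parity

namespace GoldstonSuriajaya

open Literature.NumberTheory.Sieve

/-! ### `∑_b ψ(X; q, b)²` as a sum over pairs `n ≡ n' (mod q)` -/

/-- `T(X, q) = ∑_{b mod q} ψ(X; q, b)²`, the sharp-cutoff analogue of Goldston–Suriajaya's
`𝒯(q) = (1/q)∑_a |Ψ(re(a/q))|² = ∑_{b=1}^q Ψ(r; q, b)²`. [cite: GoldstonSuriajaya2021, §7 (Tq)] -/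
def residueSquareSum (q : ℕ) [NeZero q] (X : ℕ) : ℝ :=
  ∑ b : ZMod q, ParityWave0.chebyshevPsiMod q b X ^ 2

/-- The symmetric kernel `Λ(n)Λ(n') 𝟙_{n ≡ n' (mod q)}`. [folklore] -/
def pairKernel (q : ℕ) (n n' : ℕ) : ℝ :=
  if (n : ZMod q) = (n' : ZMod q) then Λ n * Λ n' else 0

variable (q : ℕ)

/-- `ψ(X; q, b) = ∑_{n ≤ X} Λ(n) 𝟙_{n ≡ b}` for natural `X`. [folklore] -/
theorem chebyshevPsiMod_natCast (b : ZMod q) (X : ℕ) :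
    ParityWave0.chebyshevPsiMod q b X =
      ∑ n ∈ range (X + 1), if (n : ZMod q) = b then Λ n else 0 := by
  rw [ParityWave0.chebyshevPsiMod, Nat.floor_natCast]
  refine sum_congr rfl fun n _ => ?_
  simp only [ArithmeticFunction.vonMangoldt.residueClass, Set.indicator_apply, Set.mem_setOf_eq]

/-- `T(X, q) = ∑_{n, n' ≤ X} Λ(n)Λ(n') 𝟙_{n ≡ n' (mod q)}` (regrouping the double sum by the
common residue class; the sharp form of GS21's `𝒯(q) = ∑_b Ψ(r; q, b)²`).
[cite: GoldstonSuriajaya2021, §7 (display before (Tq4))] -/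
theorem residueSquareSum_eq_sum_sum [NeZero q] (X : ℕ) :
    residueSquareSum q X = ∑ n ∈ range (X + 1), ∑ n' ∈ range (X + 1), pairKernel q n n' := by
  unfold residueSquareSum
  simp_rw [chebyshevPsiMod_natCast, sq, sum_mul_sum]
  rw [sum_comm]
  refine sum_congr rfl fun n _ => ?_
  rw [sum_comm]
  refine sum_congr rfl fun n' _ => ?_
  rw [Finset.sum_eq_single (n : ZMod q)]
  · unfold pairKernel
    rw [if_pos rfl]
    by_cases h : (n : ZMod q) = (n' : ZMod q)
    · rw [if_pos h.symm, if_pos h]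
    · rw [if_neg (Ne.symm h), if_neg h, mul_zero]
  · intro b _ hb
    rw [if_neg (Ne.symm hb), zero_mul]
  · intro h
    exact absurd (mem_univ _) h

/-- The kernel is symmetric. [folklore] -/
theorem pairKernel_comm (n n' : ℕ) : pairKernel q n n' = pairKernel q n' n := by
  unfold pairKernel
  by_cases h : (n : ZMod q) = (n' : ZMod q)
  · rw [if_pos h, if_pos h.symm, mul_comm]
  · rw [if_neg h, if_neg (Ne.symm h)]

/-- The kernel is non-negative. [folklore] -/
theorem pairKernel_nonneg (n n' : ℕ) : 0 ≤ pairKernel q n n' := by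
  unfold pairKernel
  split_ifs
  · exact mul_nonneg ArithmeticFunction.vonMangoldt_nonneg ArithmeticFunction.vonMangoldt_nonneg
  · exact le_rfl

/-- On the diagonal the kernel is `Λ(n)²`. [folklore] -/
theorem pairKernel_self (n : ℕ) : pairKernel q n n = Λ n ^ 2 := by
  unfold pairKernel
  rw [if_pos rfl, sq]

/-- At the shifted pair `(n, n + k)` the kernel is `𝟙_{q ∣ k} Λ(n)Λ(n + k)`. [folklore] -/
theorem pairKernel_add (n k : ℕ) :
    pairKernel q n (n + k) = if q ∣ k then Λ n * Λ (n + k) else 0 := by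
  unfold pairKernel
  have : ((n : ZMod q) = ((n + k : ℕ) : ZMod q)) ↔ q ∣ k := by
    rw [← ZMod.natCast_eq_zero_iff, Nat.cast_add]
    constructor
    · intro h
      exact left_eq_add.mp h
    · intro h
      rw [h, add_zero]
  by_cases h : q ∣ k
  · rw [if_pos (this.mpr h), if_pos h]
  · rw [if_neg (fun h' => h (this.mp h')), if_neg h]

/-- **Diagonal + twice the triangle.** `∑_{n,n' ≤ X} K(n,n') = ∑_{n ≤ X} Λ(n)² +
2 ∑_{n ≤ X} ∑_{n < n'' ≤ X} K(n, n'')` for the symmetric kernel `K` (GS21 (|Psi|^2):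
`|Ψ(z)|² = Ψ₂(r,0) + 2 Re ∑_k Ψ₂(r,k)e(kα)`). [cite: GoldstonSuriajaya2021, §7 (|Psi|^2)] -/
theorem sum_sum_pairKernel_eq (X : ℕ) :
    ∑ n ∈ range (X + 1), ∑ n' ∈ range (X + 1), pairKernel q n n' =
      ∑ n ∈ range (X + 1), Λ n ^ 2 +
        2 * ∑ n ∈ range (X + 1), ∑ n' ∈ Ico (n + 1) (X + 1), pairKernel q n n' := by
  have hsplit : ∀ n ∈ range (X + 1), ∑ n' ∈ range (X + 1), pairKernel q n n' =
      ∑ n' ∈ range n, pairKernel q n n' + Λ n ^ 2 +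
        ∑ n' ∈ Ico (n + 1) (X + 1), pairKernel q n n' := by
    intro n hn
    rw [mem_range] at hn
    rw [range_eq_Ico, ← sum_Ico_consecutive _ (Nat.zero_le n) hn.le, sum_eq_sum_Ico_succ_bot hn,
      pairKernel_self, range_eq_Ico]
    ring
  rw [sum_congr rfl hsplit, sum_add_distrib, sum_add_distrib]
  have hlower : ∑ n ∈ range (X + 1), ∑ n' ∈ range n, pairKernel q n n' =
      ∑ n ∈ range (X + 1), ∑ n' ∈ Ico (n + 1) (X + 1), pairKernel q n n' := by
    rw [sum_comm' (s' := fun n' => Ico (n' + 1) (X + 1)) (t' := range (X + 1))]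
    · exact sum_congr rfl fun n' _ => sum_congr rfl fun n _ => pairKernel_comm q n n'
    · intro n n'
      simp only [mem_range, mem_Ico]
      omega
  rw [hlower]
  ring

/-- The triangle, re-indexed by the shift `k = n'' − n`:
`∑_{n ≤ X} ∑_{n < n'' ≤ X} K(n, n'') = ∑_{1 ≤ k ≤ X} 𝟙_{q ∣ k} ∑_{0 < n ≤ X − k} Λ(n)Λ(n + k)`.
[folklore] -/
theorem sum_Ico_pairKernel_eq (X : ℕ) :
    ∑ n ∈ range (X + 1), ∑ n' ∈ Ico (n + 1) (X + 1), pairKernel q n n' =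
      ∑ k ∈ Icc 1 X, if q ∣ k then ∑ n ∈ range (X - k + 1), Λ n * Λ (n + k) else 0 := by
  -- rewrite the inner sum over `n''` as a sum over the shift `k`
  have hinner : ∀ n ∈ range (X + 1), ∑ n' ∈ Ico (n + 1) (X + 1), pairKernel q n n' =
      ∑ k ∈ Icc 1 X, if n + k ≤ X then pairKernel q n (n + k) else 0 := by
    intro n hn
    rw [mem_range] at hn
    rw [← sum_filter]
    have hset : (Icc 1 X).filter (fun k => n + k ≤ X) = Icc 1 (X - n) := by
      ext k
      simp only [mem_filter, mem_Icc]
      omega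
    rw [hset]
    have hmap : Ico (n + 1) (X + 1) = (Icc 1 (X - n)).map (addLeftEmbedding n) := by
      rw [map_add_left_Icc, Nat.add_sub_cancel' (Nat.lt_succ_iff.mp hn), Ico_add_one_right_eq_Icc]
    rw [hmap, sum_map]
    rfl
  rw [sum_congr rfl hinner, sum_comm]
  refine sum_congr rfl fun k hk => ?_
  rw [mem_Icc] at hk
  simp_rw [pairKernel_add]
  by_cases hqk : q ∣ k
  · simp only [if_pos hqk]
    rw [← sum_filter]
    have hset : (range (X + 1)).filter (fun n => n + k ≤ X) = range (X - k + 1) := by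
      ext n
      simp only [mem_filter, mem_range]
      omega
    rw [hset]
  · simp only [if_neg hqk, ite_self, sum_const_zero]

/-- `∑_{0 ≤ n ≤ X − k} Λ(n)Λ(n + k) = ψ₂(X, k)` for `1 ≤ k ≤ X` (shift `n ↦ n + k`; the term
`n = 0` vanishes). [cite: GoldstonSuriajaya2021, (7)] -/
theorem sum_range_mul_shift_eq (X : ℕ) {k : ℕ} (hk : k ≤ X) :
    ∑ n ∈ range (X - k + 1), Λ n * Λ (n + k) = primePairLambdaCount X k := by
  rw [primePairLambdaCount, Nat.floor_natCast, range_eq_Ico, sum_eq_sum_Ico_succ_bot (Nat.succ_pos _),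
    ArithmeticFunction.map_zero, zero_mul, zero_add]
  have hIco : Ico (0 + 1) (X - k + 1) = Ioc 0 (X - k) := by
    ext n
    simp only [mem_Ico, mem_Ioc]
    omega
  rw [hIco]
  have hmap : Ioc k X = (Ioc 0 (X - k)).map (addRightEmbedding k) := by
    rw [map_add_right_Ioc, zero_add, Nat.sub_add_cancel hk]
  rw [hmap, sum_map]
  refine sum_congr rfl fun n _ => ?_
  simp only [addRightEmbedding_apply, Nat.add_sub_cancel]
  ring

/-- **GS21 (|Psi|^2)–(Tq), sharp form**: `∑_b ψ(X; q, b)² = ∑_{n ≤ X} Λ(n)² +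
2 ∑_{1 ≤ k ≤ X, q ∣ k} ψ₂(X, k)`. [cite: GoldstonSuriajaya2021, §7 (Tq)] -/
theorem residueSquareSum_eq [NeZero q] (X : ℕ) :
    residueSquareSum q X = ∑ n ∈ range (X + 1), Λ n ^ 2 +
      2 * ∑ k ∈ Icc 1 X, if q ∣ k then primePairLambdaCount X k else 0 := by
  rw [residueSquareSum_eq_sum_sum, sum_sum_pairKernel_eq, sum_Ico_pairKernel_eq]
  congr 2
  refine sum_congr rfl fun k hk => ?_
  rw [mem_Icc] at hk
  split_ifs
  · rw [sum_range_mul_shift_eq X hk.2]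
  · rfl

/-- The diagonal: `∑_{n ≤ X} Λ(n)² ≤ (X + 1) log²X` (GS21 (Psi_2(r,0)): `Ψ₂(r,0) ≪ N log N`).
[cite: GoldstonSuriajaya2021, §7 (Psi_2(r,0))] -/
theorem sum_vonMangoldt_sq_le (X : ℕ) :
    ∑ n ∈ range (X + 1), Λ n ^ 2 ≤ (X + 1) * Real.log X ^ 2 := by
  have hterm : ∀ n ∈ range (X + 1), Λ n ^ 2 ≤ Real.log X ^ 2 := by
    intro n hn
    rw [mem_range] at hn
    rcases Nat.eq_zero_or_pos n with rfl | hn0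
    · rw [ArithmeticFunction.map_zero, sq, zero_mul]
      positivity
    · have h1 : Λ n ≤ Real.log X :=
        ArithmeticFunction.vonMangoldt_le_log.trans
          (Real.log_le_log (by exact_mod_cast hn0) (by exact_mod_cast Nat.lt_succ_iff.mp hn))
      exact pow_le_pow_left₀ ArithmeticFunction.vonMangoldt_nonneg h1 2
  calc ∑ n ∈ range (X + 1), Λ n ^ 2 ≤ ∑ _n ∈ range (X + 1), Real.log X ^ 2 := sum_le_sum hterm
    _ = (X + 1) * Real.log X ^ 2 := by rw [sum_const, card_range, nsmul_eq_mul]; push_cast; ring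

/-! ### The singular series over the multiples of `q` (from the tree's GS21 Lemma 1) -/

/-- The multiples of `q` in `[1, m]` are the `qj`, `1 ≤ j ≤ m/q`. [folklore] -/
theorem filter_dvd_Icc_eq_image {q : ℕ} (hq : 0 < q) (m : ℕ) :
    (Icc 1 m).filter (q ∣ ·) = (Ioc 0 (m / q)).image (q * ·) := by
  ext k
  simp only [mem_filter, mem_Icc, mem_image, mem_Ioc]
  constructor
  · rintro ⟨⟨hk1, hkm⟩, j, rfl⟩
    refine ⟨j, ⟨Nat.pos_of_ne_zero ?_, ?_⟩, rfl⟩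
    · rintro rfl
      rw [mul_zero] at hk1
      exact absurd hk1 (by norm_num)
    · rw [Nat.le_div_iff_mul_le hq, mul_comm]
      exact hkm
  · rintro ⟨j, ⟨hj0, hjm⟩, rfl⟩
    refine ⟨⟨Nat.mul_pos hq hj0, ?_⟩, Dvd.intro j rfl⟩
    rw [Nat.le_div_iff_mul_le hq] at hjm
    rw [mul_comm]
    exact hjm

/-- `∑_{1 ≤ k ≤ m, q ∣ k} 𝔖(k) ≤ m/φ(q)`, uniformly in `q ≥ 1` and `m` (from the tree's
`G_q(K) ≤ (q/φ(q))K`, GS21 Lemma 1 (Montgomery), upper half).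
[cite: GoldstonSuriajaya2021, Lemma 1 (lem1)] -/
theorem sum_filter_dvd_goldbachSingularSeries_le {q : ℕ} (hq : q ≠ 0) (m : ℕ) :
    ∑ k ∈ (Icc 1 m).filter (q ∣ ·), goldbachSingularSeries k ≤ (m : ℝ) / Nat.totient q := by
  have hq0 : 0 < q := Nat.pos_of_ne_zero hq
  have hφ : (0 : ℝ) < Nat.totient q := by exact_mod_cast Nat.totient_pos.mpr hq0
  have hqR : (0 : ℝ) < q := by exact_mod_cast hq0
  rw [filter_dvd_Icc_eq_image hq0,
    sum_image fun x _ y _ h => Nat.eq_of_mul_eq_mul_left hq0 h]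
  calc ∑ j ∈ Ioc 0 (m / q), goldbachSingularSeries (q * j)
      ≤ (q : ℝ) / (Nat.totient q : ℝ) * ((m / q : ℕ) : ℝ) :=
        SingularSeriesMean.sum_goldbachSingularSeries_mul_le hq _
    _ ≤ (q : ℝ) / (Nat.totient q : ℝ) * ((m : ℝ) / q) := by
        gcongr
        exact Nat.cast_div_le
    _ = (m : ℝ) / Nat.totient q := by
        field_simp

/-- **GS21 (Slast)/(V_q=), sharp form**: `∑_{1 ≤ k ≤ X, q ∣ k} 𝔖(k)(X − k) ≤ X²/(2φ(q))`
(write `X − k = #[k, X)`, exchange, and bound each partial sum `∑_{k ≤ m, q ∣ k} 𝔖(k) ≤ m/φ(q)`).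
[cite: GoldstonSuriajaya2021, §7 (Slast)] -/
theorem sum_goldbachSingularSeries_mul_sub_le {q : ℕ} (hq : q ≠ 0) (X : ℕ) :
    ∑ k ∈ Icc 1 X, (if q ∣ k then goldbachSingularSeries k * ((X : ℝ) - k) else 0) ≤
      (X : ℝ) ^ 2 / (2 * Nat.totient q) := by
  have hφ : (0 : ℝ) < Nat.totient q := by exact_mod_cast Nat.totient_pos.mpr (Nat.pos_of_ne_zero hq)
  -- `X − k = ∑_{m ∈ [k, X)} 1`
  have hstep : ∀ k ∈ Icc 1 X, (if q ∣ k then goldbachSingularSeries k * ((X : ℝ) - k) else 0) =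
      ∑ m ∈ Ico k X, if q ∣ k then goldbachSingularSeries k else 0 := by
    intro k hk
    rw [mem_Icc] at hk
    rw [sum_const, Nat.card_Ico, nsmul_eq_mul, Nat.cast_sub hk.2]
    split_ifs
    · ring
    · rw [mul_zero]
  rw [sum_congr rfl hstep,
    sum_comm' (s' := fun m => Icc 1 m) (t' := range X) (fun k m => by
      simp only [mem_Icc, mem_Ico, mem_range]; omega)]
  calc ∑ m ∈ range X, ∑ k ∈ Icc 1 m, (if q ∣ k then goldbachSingularSeries k else 0)
      ≤ ∑ m ∈ range X, (m : ℝ) / Nat.totient q := by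
        refine sum_le_sum fun m _ => ?_
        rw [← sum_filter]
        exact sum_filter_dvd_goldbachSingularSeries_le hq m
    _ = (∑ m ∈ range X, (m : ℝ)) / Nat.totient q := by rw [sum_div]
    _ ≤ ((X : ℝ) ^ 2 / 2) / Nat.totient q := by
        gcongr
        have h := congrArg (Nat.cast (R := ℝ)) (sum_range_id_mul_two X)
        push_cast at h
        have h' : (∑ m ∈ range X, (m : ℝ)) * 2 = (X : ℝ) * ((X - 1 : ℕ) : ℝ) := h
        have h'' : ((X - 1 : ℕ) : ℝ) ≤ X := by exact_mod_cast Nat.sub_le X 1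
        have hX : (0 : ℝ) ≤ X := Nat.cast_nonneg X
        nlinarith
    _ = (X : ℝ) ^ 2 / (2 * Nat.totient q) := by rw [div_div]

/-! ### The upper bound for `∑_b ψ(X; q, b)²` from the conjectured prime-pair bound -/

/-- **GS21 (Tqbound), sharp form.** Let `q` be even. If the Hardy–Littlewood Prime-Pair Upper
Bound inequality `ψ₂(X, k) ≤ (2 − δ)𝔖(k)(X − k) + η𝔖(k)X` holds for every even `2 ≤ k ≤ X`
(`δ ≤ 2`, `η ≥ 0`), then `∑_b ψ(X; q, b)² ≤ (X + 1)log²X + (2 − δ + 2η)X²/φ(q)`: all shifts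
`k ≡ 0 (mod q)` are even, and `∑_{k ≤ X, q∣k} 𝔖(k)(X − k) ≤ X²/(2φ(q))`,
`∑_{k ≤ X, q ∣ k} 𝔖(k)X ≤ X²/φ(q)`. [cite: GoldstonSuriajaya2021, §7 (Tqbound)] -/
theorem residueSquareSum_le {q : ℕ} [NeZero q] (hq : Even q) {X : ℕ} {δ η : ℝ} (hδ : δ ≤ 2)
    (hη : 0 ≤ η)
    (hconj : ∀ k : ℕ, Even k → 2 ≤ k → k ≤ X →
      primePairLambdaCount X k ≤
        (2 - δ) * goldbachSingularSeries k * ((X : ℝ) - k) + η * (goldbachSingularSeries k * X)) :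
    residueSquareSum q X ≤
      ((X : ℝ) + 1) * Real.log X ^ 2 + (2 - δ + 2 * η) * (X : ℝ) ^ 2 / Nat.totient q := by
  have hq0 : q ≠ 0 := NeZero.ne q
  have hφ : (0 : ℝ) < Nat.totient q := by exact_mod_cast Nat.totient_pos.mpr (Nat.pos_of_ne_zero hq0)
  rw [residueSquareSum_eq]
  -- the shifted pair counts, bounded by the conjecture shift by shift
  have hpairs : ∑ k ∈ Icc 1 X, (if q ∣ k then primePairLambdaCount X k else 0) ≤
      (2 - δ) * ∑ k ∈ Icc 1 X, (if q ∣ k then goldbachSingularSeries k * ((X : ℝ) - k) else 0) +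
        η * ∑ k ∈ Icc 1 X, (if q ∣ k then goldbachSingularSeries k * X else 0) := by
    rw [mul_sum, mul_sum, ← sum_add_distrib]
    refine sum_le_sum fun k hk => ?_
    rw [mem_Icc] at hk
    split_ifs with hqk
    · have hk_even : Even k := by
        obtain ⟨j, rfl⟩ := hqk
        exact hq.mul_right j
      have hk2 : 2 ≤ k := by
        obtain ⟨r, hr⟩ := hk_even
        omega
      have h := hconj k hk_even hk2 hk.2
      linarith
    · simp
  have hA := sum_goldbachSingularSeries_mul_sub_le hq0 X
  have hB : ∑ k ∈ Icc 1 X, (if q ∣ k then goldbachSingularSeries k * X else 0) ≤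
      (X : ℝ) ^ 2 / Nat.totient q := by
    rw [← sum_filter]
    calc ∑ k ∈ (Icc 1 X).filter (q ∣ ·), goldbachSingularSeries k * X
        = (∑ k ∈ (Icc 1 X).filter (q ∣ ·), goldbachSingularSeries k) * X := by rw [sum_mul]
      _ ≤ (X : ℝ) / Nat.totient q * X :=
          mul_le_mul_of_nonneg_right (sum_filter_dvd_goldbachSingularSeries_le hq0 X)
            (Nat.cast_nonneg X)
      _ = (X : ℝ) ^ 2 / Nat.totient q := by ring
  have hD := sum_vonMangoldt_sq_le X
  have h2δ : 0 ≤ 2 - δ := by linarith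
  have hmain : ∑ k ∈ Icc 1 X, (if q ∣ k then primePairLambdaCount X k else 0) ≤
      (2 - δ) * ((X : ℝ) ^ 2 / (2 * Nat.totient q)) + η * ((X : ℝ) ^ 2 / Nat.totient q) :=
    hpairs.trans (add_le_add (mul_le_mul_of_nonneg_left hA h2δ) (mul_le_mul_of_nonneg_left hB hη))
  have heq : 2 * ((2 - δ) * ((X : ℝ) ^ 2 / (2 * Nat.totient q)) + η * ((X : ℝ) ^ 2 / Nat.totient q)) =
      (2 - δ + 2 * η) * (X : ℝ) ^ 2 / Nat.totient q := by
    field_simp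
  linarith

end GoldstonSuriajaya

end Literature.Barriers.Parity
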